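import Mathlib
import Summits.Ventures.PercRepro.TriangleCapRowPlusFour

/-!
# PercRepro — THE CELLS `(9, 14)`, `(10, 15)`, `(11, 16)` OF THE `K₄⁻`-FREE CHERRY TABLE (`t = 6`, part A)
(p3, gen 32; part 20 — the row `m = k + 5` below its threshold, first half)

The row `t = 6` (`m = k + 5`) is the star value `C(k − 1, 2) + 12` from the threshold `k = 18` on and the bipartite
value `C(k − 1, 2) + 12 + j` at `k = 18 − j` for `j ≤ 3` (TriangleCapBelowThreshold); the cells `k = 9 … 14` are
`K_{2,7}` plus `k − 9` pendant edges (`49, 56, 64, 73, 83, 94`; the census holds `49` and `56`).  Each closes by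
TriangleCapSevenTen's cell template — the count at a vertex of maximum degree `d`: `d ≤ 4` by the degree cap
`3m`; the dominating `d = k − 1` by `T = |R| = 12 > d` (`k ≤ 12`); `d ≥ 8` by the matching pairs alone
(`Y ≥ 5T`: a matching pair is avoided by `≥ m′ + d − k = t − 1 = 5` edges off `v`); `d = 5, 6, 7` by the defect sum
seen from a vertex of maximum off-degree `δ ≥ 5`, or the split sum `Y ≥ 5T + (|R| − T)(m′ + 1 − 2δ)` for `δ ≤ 4`.
This file: `k = 9, 10, 11`; TriangleCapRowPlusFiveB: `k = 12, 13, 14` and the row.  Axioms: standard.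
-/

namespace PercRepro

namespace TriangleCap

namespace C047

open Finset

variable {V : Type*} [Fintype V] [DecidableEq V]

/-- **THE CELL `(9, 14)`, THE BOUND:** every `K₄⁻`-free graph with `14` edges on `9` vertices has
`Σ_v C(d(v), 2) ≤ 49`. -/
theorem cherries_le_forty_nine_of_k4mFree (D : SimpleGraph V) [DecidableRel D.Adj] (hK : K4mFree D)
    (hk : Fintype.card V = 9) (hm : D.edgeFinset.card = 14) : cherries D ≤ 49 := by
  by_cases hdeg : ∀ v, deg D v ≤ 4
  · -- every degree `≤ 4`: `2·cherries ≤ 3 Σ d = 6m`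
    have h2 : 2 * cherries D ≤ (4 - 1) * ∑ v, deg D v := by
      unfold cherries
      rw [mul_sum, mul_sum]
      exact sum_le_sum (fun v _ => two_mul_choose_two_le_pred_mul _ _ (hdeg v))
    rw [sum_deg_eq, hm] at h2
    omega
  · push Not at hdeg
    obtain ⟨u, hu⟩ := hdeg
    obtain ⟨v, -, hmax⟩ := exists_max_image univ (deg D) ⟨u, mem_univ u⟩
    have hmax' : ∀ w, deg D w ≤ deg D v := fun w => hmax w (mem_univ w)
    have hv : 5 ≤ deg D v := by
      have := hmax' u
      omega
    have hS := sum_adjPairsAll_deg_add D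
    have hsplit1 := sum_filter_add_sum_filter_not (adjPairsAll D) (fun p => p.1 = v)
      (fun p => deg D p.1 + deg D p.2)
    have hsplit2 := sum_filter_add_sum_filter_not ((adjPairsAll D).filter (fun p => ¬ p.1 = v))
      (fun p => p.2 = v) (fun p => deg D p.1 + deg D p.2)
    rw [filter_not_fst_filter_snd, filter_not_fst_filter_not_snd] at hsplit2
    have hfst := sum_filter_fst_deg_add D v
    have hsnd := sum_filter_snd_deg_add D v
    have hA := sum_deg_neighbors_eq D v
    have hE := two_mul_card_E_le D v
    have hT := card_T_le_deg D hK v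
    have hTT := card_T_mul_card_T_le D hK v
    have hRc := two_mul_card_edges_eq D v
    have hR1 := sum_R_add_sum_avoid_le D v
    have hc := two_mul_cherries_add D
    rw [sum_deg_eq] at hc
    have hdk : deg D v + 1 ≤ Fintype.card V := by
      have hsub : univ.filter (fun w => D.Adj v w) ⊆ univ.erase v := by
        intro w hw
        rw [mem_filter] at hw
        rw [mem_erase]
        exact ⟨(D.ne_of_adj hw.2).symm, mem_univ _⟩
      have h1 : deg D v ≤ (univ.erase v).card := card_le_card hsub
      rw [card_erase_of_mem (mem_univ v), card_univ] at h1
      have h2 : 1 ≤ Fintype.card V := Fintype.card_pos_iff.mpr ⟨v⟩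
      omega
    have hmain : 2 * (∑ x, deg D x * deg D x) + (offPairs D v).card * deg D v +
        ∑ p ∈ offPairs D v, (avoid D v p).card ≤
        2 * (deg D v * deg D v) + 2 * deg D v +
          4 * ((offPairs D v).filter (fun p => D.Adj v p.1)).card +
          (offPairs D v).card * D.edgeFinset.card + (offPairs D v).card := by
      linarith [hS, hsplit1, hsplit2, hfst, hsnd, hA, hR1]
    have hdom : deg D v + 1 = Fintype.card V →
        ((offPairs D v).filter (fun p => D.Adj v p.1 ∧ D.Adj v p.2)).card = (offPairs D v).card :=
      fun h => congrArg card (filter_T_eq_offPairs_of_deg_add_one_eq_card D h)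
    have hEc := card_offEdges D v
    obtain ⟨c, -, hcmax⟩ := exists_max_image univ (outDeg D v) ⟨v, mem_univ v⟩
    have hcmax' : ∀ w, outDeg D v w ≤ outDeg D v c := fun w => hcmax w (mem_univ w)
    have hδd : outDeg D v c ≤ deg D v := (outDeg_le_deg D v c).trans (hmax' c)
    have hδ1 := sum_avoid_ge_of_outDeg D v c
    have hL := sum_avoid_ge_of_T_of_outDeg_le D hK v (outDeg D v c) hcmax'
    set T := ((offPairs D v).filter (fun p => D.Adj v p.1 ∧ D.Adj v p.2)).card with hTdef
    set E := ((offPairs D v).filter (fun p => D.Adj v p.1)).card with hEdef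
    set Rc := (offPairs D v).card with hRcdef
    set Y := ∑ p ∈ offPairs D v, (avoid D v p).card with hYdef
    set Ec := (offEdges D v).card with hEcdef
    set δ := outDeg D v c with hδdef
    set d := deg D v with hddef
    set m := D.edgeFinset.card with hmdef
    set k := Fintype.card V with hkdef
    set ch := cherries D with hchdef
    set s2 := ∑ x, deg D x * deg D x with hs2def
    clear_value T E Rc Y Ec δ d m k ch s2
    have hfin : 2 * s2 + Rc * d + Y ≤ 2 * (d * d) + 2 * d + 2 * Rc + 2 * T + Rc * m + Rc := by
      linarith [hmain, hE]
    clear hmain hS hsplit1 hsplit2 hfst hsnd hA hR1 hE hTdef hEdef hRcdef hYdef hEcdef hδdef hddef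
      hmdef hkdef hchdef hs2def hmax hmax' hcmax hcmax' hu
    subst hk hm
    obtain ⟨a, rfl⟩ : ∃ a, d = 5 + a := ⟨d - 5, by omega⟩
    rcases (by omega : a = 0 ∨ a = 1 ∨ a = 2 ∨ a = 3) with rfl | rfl | rfl | rfl
    · -- maximum degree `5`: `|R| = 18`, `m′ = 9`
      have hRc' : Rc = 18 := by omega
      have hEc' : Ec = 9 := by omega
      subst hRc' hEc'
      have hY : 2 * T + 24 ≤ Y := by
        by_cases hδ5 : 5 ≤ δ
        · have hδ' : δ = 5 := by omega
          subst hδ'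
          omega
        · have h1 : (18 - T) * (9 - 7) ≤ (18 - T) * (9 + 1 - 2 * δ) := Nat.mul_le_mul_left _ (by omega)
          omega
      omega
    · -- maximum degree `6`: `|R| = 16`, `m′ = 8`
      have hRc' : Rc = 16 := by omega
      have hEc' : Ec = 8 := by omega
      subst hRc' hEc'
      have hY : 2 * T + 8 ≤ Y := by
        by_cases hδ5 : 5 ≤ δ
        · rcases (by omega : δ = 5 ∨ δ = 6) with hδ' | hδ' <;> subst hδ' <;> omega
        · have h1 : (16 - T) * (8 - 7) ≤ (16 - T) * (8 + 1 - 2 * δ) := Nat.mul_le_mul_left _ (by omega)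
          omega
      omega
    · -- maximum degree `7`: `|R| = 14`, `m′ = 7`
      have hRc' : Rc = 14 := by omega
      have hEc' : Ec = 7 := by omega
      subst hRc' hEc'
      have h0 := Nat.zero_le ((14 - T) * (7 + 1 - 2 * δ))
      omega
    · -- maximum degree `8`: `|R| = 12`, `m′ = 6`
      have hT2 := hdom (by omega)
      omega

/-- **THE CELL `(10, 15)`, THE BOUND:** every `K₄⁻`-free graph with `15` edges on `10` vertices has
`Σ_v C(d(v), 2) ≤ 56`. -/
theorem cherries_le_fifty_six_of_k4mFree (D : SimpleGraph V) [DecidableRel D.Adj] (hK : K4mFree D)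
    (hk : Fintype.card V = 10) (hm : D.edgeFinset.card = 15) : cherries D ≤ 56 := by
  by_cases hdeg : ∀ v, deg D v ≤ 4
  · -- every degree `≤ 4`: `2·cherries ≤ 3 Σ d = 6m`
    have h2 : 2 * cherries D ≤ (4 - 1) * ∑ v, deg D v := by
      unfold cherries
      rw [mul_sum, mul_sum]
      exact sum_le_sum (fun v _ => two_mul_choose_two_le_pred_mul _ _ (hdeg v))
    rw [sum_deg_eq, hm] at h2
    omega
  · push Not at hdeg
    obtain ⟨u, hu⟩ := hdeg
    obtain ⟨v, -, hmax⟩ := exists_max_image univ (deg D) ⟨u, mem_univ u⟩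
    have hmax' : ∀ w, deg D w ≤ deg D v := fun w => hmax w (mem_univ w)
    have hv : 5 ≤ deg D v := by
      have := hmax' u
      omega
    have hS := sum_adjPairsAll_deg_add D
    have hsplit1 := sum_filter_add_sum_filter_not (adjPairsAll D) (fun p => p.1 = v)
      (fun p => deg D p.1 + deg D p.2)
    have hsplit2 := sum_filter_add_sum_filter_not ((adjPairsAll D).filter (fun p => ¬ p.1 = v))
      (fun p => p.2 = v) (fun p => deg D p.1 + deg D p.2)
    rw [filter_not_fst_filter_snd, filter_not_fst_filter_not_snd] at hsplit2
    have hfst := sum_filter_fst_deg_add D v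
    have hsnd := sum_filter_snd_deg_add D v
    have hA := sum_deg_neighbors_eq D v
    have hE := two_mul_card_E_le D v
    have hT := card_T_le_deg D hK v
    have hTT := card_T_mul_card_T_le D hK v
    have hRc := two_mul_card_edges_eq D v
    have hR1 := sum_R_add_sum_avoid_le D v
    have hc := two_mul_cherries_add D
    rw [sum_deg_eq] at hc
    have hdk : deg D v + 1 ≤ Fintype.card V := by
      have hsub : univ.filter (fun w => D.Adj v w) ⊆ univ.erase v := by
        intro w hw
        rw [mem_filter] at hw
        rw [mem_erase]
        exact ⟨(D.ne_of_adj hw.2).symm, mem_univ _⟩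
      have h1 : deg D v ≤ (univ.erase v).card := card_le_card hsub
      rw [card_erase_of_mem (mem_univ v), card_univ] at h1
      have h2 : 1 ≤ Fintype.card V := Fintype.card_pos_iff.mpr ⟨v⟩
      omega
    have hmain : 2 * (∑ x, deg D x * deg D x) + (offPairs D v).card * deg D v +
        ∑ p ∈ offPairs D v, (avoid D v p).card ≤
        2 * (deg D v * deg D v) + 2 * deg D v +
          4 * ((offPairs D v).filter (fun p => D.Adj v p.1)).card +
          (offPairs D v).card * D.edgeFinset.card + (offPairs D v).card := by
      linarith [hS, hsplit1, hsplit2, hfst, hsnd, hA, hR1]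
    have hdom : deg D v + 1 = Fintype.card V →
        ((offPairs D v).filter (fun p => D.Adj v p.1 ∧ D.Adj v p.2)).card = (offPairs D v).card :=
      fun h => congrArg card (filter_T_eq_offPairs_of_deg_add_one_eq_card D h)
    have hEc := card_offEdges D v
    obtain ⟨c, -, hcmax⟩ := exists_max_image univ (outDeg D v) ⟨v, mem_univ v⟩
    have hcmax' : ∀ w, outDeg D v w ≤ outDeg D v c := fun w => hcmax w (mem_univ w)
    have hδd : outDeg D v c ≤ deg D v := (outDeg_le_deg D v c).trans (hmax' c)
    have hδ1 := sum_avoid_ge_of_outDeg D v c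
    have hL := sum_avoid_ge_of_T_of_outDeg_le D hK v (outDeg D v c) hcmax'
    set T := ((offPairs D v).filter (fun p => D.Adj v p.1 ∧ D.Adj v p.2)).card with hTdef
    set E := ((offPairs D v).filter (fun p => D.Adj v p.1)).card with hEdef
    set Rc := (offPairs D v).card with hRcdef
    set Y := ∑ p ∈ offPairs D v, (avoid D v p).card with hYdef
    set Ec := (offEdges D v).card with hEcdef
    set δ := outDeg D v c with hδdef
    set d := deg D v with hddef
    set m := D.edgeFinset.card with hmdef
    set k := Fintype.card V with hkdef
    set ch := cherries D with hchdef
    set s2 := ∑ x, deg D x * deg D x with hs2def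
    clear_value T E Rc Y Ec δ d m k ch s2
    have hfin : 2 * s2 + Rc * d + Y ≤ 2 * (d * d) + 2 * d + 2 * Rc + 2 * T + Rc * m + Rc := by
      linarith [hmain, hE]
    clear hmain hS hsplit1 hsplit2 hfst hsnd hA hR1 hE hTdef hEdef hRcdef hYdef hEcdef hδdef hddef
      hmdef hkdef hchdef hs2def hmax hmax' hcmax hcmax' hu
    subst hk hm
    obtain ⟨a, rfl⟩ : ∃ a, d = 5 + a := ⟨d - 5, by omega⟩
    rcases (by omega : a = 0 ∨ a = 1 ∨ a = 2 ∨ a = 3 ∨ a = 4) with rfl | rfl | rfl | rfl | rfl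
    · -- maximum degree `5`: `|R| = 20`, `m′ = 10`
      have hRc' : Rc = 20 := by omega
      have hEc' : Ec = 10 := by omega
      subst hRc' hEc'
      have hY : 2 * T + 36 ≤ Y := by
        by_cases hδ5 : 5 ≤ δ
        · have hδ' : δ = 5 := by omega
          subst hδ'
          omega
        · have h1 : (20 - T) * (10 - 7) ≤ (20 - T) * (10 + 1 - 2 * δ) := Nat.mul_le_mul_left _ (by omega)
          omega
      omega
    · -- maximum degree `6`: `|R| = 18`, `m′ = 9`
      have hRc' : Rc = 18 := by omega
      have hEc' : Ec = 9 := by omega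
      subst hRc' hEc'
      have hY : 2 * T + 16 ≤ Y := by
        by_cases hδ5 : 5 ≤ δ
        · rcases (by omega : δ = 5 ∨ δ = 6) with hδ' | hδ' <;> subst hδ' <;> omega
        · have h1 : (18 - T) * (9 - 7) ≤ (18 - T) * (9 + 1 - 2 * δ) := Nat.mul_le_mul_left _ (by omega)
          omega
      omega
    · -- maximum degree `7`: `|R| = 16`, `m′ = 8`
      have hRc' : Rc = 16 := by omega
      have hEc' : Ec = 8 := by omega
      subst hRc' hEc'
      have hY : 2 * T + 4 ≤ Y := by
        by_cases hδ5 : 5 ≤ δ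
        · rcases (by omega : δ = 5 ∨ δ = 6 ∨ δ = 7) with hδ' | hδ' | hδ' <;> subst hδ' <;> omega
        · have h1 : (16 - T) * (8 - 7) ≤ (16 - T) * (8 + 1 - 2 * δ) := Nat.mul_le_mul_left _ (by omega)
          omega
      omega
    · -- maximum degree `8`: `|R| = 14`, `m′ = 7`
      have hRc' : Rc = 14 := by omega
      have hEc' : Ec = 7 := by omega
      subst hRc' hEc'
      have h0 := Nat.zero_le ((14 - T) * (7 + 1 - 2 * δ))
      omega
    · -- maximum degree `9`: `|R| = 12`, `m′ = 6`
      have hT2 := hdom (by omega)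
      omega

/-- **THE CELL `(11, 16)`, THE BOUND:** every `K₄⁻`-free graph with `16` edges on `11` vertices has
`Σ_v C(d(v), 2) ≤ 64`. -/
theorem cherries_le_sixty_four_of_k4mFree (D : SimpleGraph V) [DecidableRel D.Adj] (hK : K4mFree D)
    (hk : Fintype.card V = 11) (hm : D.edgeFinset.card = 16) : cherries D ≤ 64 := by
  by_cases hdeg : ∀ v, deg D v ≤ 4
  · -- every degree `≤ 4`: `2·cherries ≤ 3 Σ d = 6m`
    have h2 : 2 * cherries D ≤ (4 - 1) * ∑ v, deg D v := by
      unfold cherries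
      rw [mul_sum, mul_sum]
      exact sum_le_sum (fun v _ => two_mul_choose_two_le_pred_mul _ _ (hdeg v))
    rw [sum_deg_eq, hm] at h2
    omega
  · push Not at hdeg
    obtain ⟨u, hu⟩ := hdeg
    obtain ⟨v, -, hmax⟩ := exists_max_image univ (deg D) ⟨u, mem_univ u⟩
    have hmax' : ∀ w, deg D w ≤ deg D v := fun w => hmax w (mem_univ w)
    have hv : 5 ≤ deg D v := by
      have := hmax' u
      omega
    have hS := sum_adjPairsAll_deg_add D
    have hsplit1 := sum_filter_add_sum_filter_not (adjPairsAll D) (fun p => p.1 = v)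
      (fun p => deg D p.1 + deg D p.2)
    have hsplit2 := sum_filter_add_sum_filter_not ((adjPairsAll D).filter (fun p => ¬ p.1 = v))
      (fun p => p.2 = v) (fun p => deg D p.1 + deg D p.2)
    rw [filter_not_fst_filter_snd, filter_not_fst_filter_not_snd] at hsplit2
    have hfst := sum_filter_fst_deg_add D v
    have hsnd := sum_filter_snd_deg_add D v
    have hA := sum_deg_neighbors_eq D v
    have hE := two_mul_card_E_le D v
    have hT := card_T_le_deg D hK v
    have hTT := card_T_mul_card_T_le D hK v
    have hRc := two_mul_card_edges_eq D v
    have hR1 := sum_R_add_sum_avoid_le D v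
    have hc := two_mul_cherries_add D
    rw [sum_deg_eq] at hc
    have hdk : deg D v + 1 ≤ Fintype.card V := by
      have hsub : univ.filter (fun w => D.Adj v w) ⊆ univ.erase v := by
        intro w hw
        rw [mem_filter] at hw
        rw [mem_erase]
        exact ⟨(D.ne_of_adj hw.2).symm, mem_univ _⟩
      have h1 : deg D v ≤ (univ.erase v).card := card_le_card hsub
      rw [card_erase_of_mem (mem_univ v), card_univ] at h1
      have h2 : 1 ≤ Fintype.card V := Fintype.card_pos_iff.mpr ⟨v⟩
      omega
    have hmain : 2 * (∑ x, deg D x * deg D x) + (offPairs D v).card * deg D v +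
        ∑ p ∈ offPairs D v, (avoid D v p).card ≤
        2 * (deg D v * deg D v) + 2 * deg D v +
          4 * ((offPairs D v).filter (fun p => D.Adj v p.1)).card +
          (offPairs D v).card * D.edgeFinset.card + (offPairs D v).card := by
      linarith [hS, hsplit1, hsplit2, hfst, hsnd, hA, hR1]
    have hdom : deg D v + 1 = Fintype.card V →
        ((offPairs D v).filter (fun p => D.Adj v p.1 ∧ D.Adj v p.2)).card = (offPairs D v).card :=
      fun h => congrArg card (filter_T_eq_offPairs_of_deg_add_one_eq_card D h)
    have hEc := card_offEdges D v
    obtain ⟨c, -, hcmax⟩ := exists_max_image univ (outDeg D v) ⟨v, mem_univ v⟩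
    have hcmax' : ∀ w, outDeg D v w ≤ outDeg D v c := fun w => hcmax w (mem_univ w)
    have hδd : outDeg D v c ≤ deg D v := (outDeg_le_deg D v c).trans (hmax' c)
    have hδ1 := sum_avoid_ge_of_outDeg D v c
    have hL := sum_avoid_ge_of_T_of_outDeg_le D hK v (outDeg D v c) hcmax'
    set T := ((offPairs D v).filter (fun p => D.Adj v p.1 ∧ D.Adj v p.2)).card with hTdef
    set E := ((offPairs D v).filter (fun p => D.Adj v p.1)).card with hEdef
    set Rc := (offPairs D v).card with hRcdef
    set Y := ∑ p ∈ offPairs D v, (avoid D v p).card with hYdef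
    set Ec := (offEdges D v).card with hEcdef
    set δ := outDeg D v c with hδdef
    set d := deg D v with hddef
    set m := D.edgeFinset.card with hmdef
    set k := Fintype.card V with hkdef
    set ch := cherries D with hchdef
    set s2 := ∑ x, deg D x * deg D x with hs2def
    clear_value T E Rc Y Ec δ d m k ch s2
    have hfin : 2 * s2 + Rc * d + Y ≤ 2 * (d * d) + 2 * d + 2 * Rc + 2 * T + Rc * m + Rc := by
      linarith [hmain, hE]
    clear hmain hS hsplit1 hsplit2 hfst hsnd hA hR1 hE hTdef hEdef hRcdef hYdef hEcdef hδdef hddef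
      hmdef hkdef hchdef hs2def hmax hmax' hcmax hcmax' hu
    subst hk hm
    obtain ⟨a, rfl⟩ : ∃ a, d = 5 + a := ⟨d - 5, by omega⟩
    rcases (by omega : a = 0 ∨ a = 1 ∨ a = 2 ∨ a = 3 ∨ a = 4 ∨ a = 5) with rfl | rfl | rfl | rfl | rfl | rfl
    · -- maximum degree `5`: `|R| = 22`, `m′ = 11`
      have hRc' : Rc = 22 := by omega
      have hEc' : Ec = 11 := by omega
      subst hRc' hEc'
      have hY : 2 * T + 48 ≤ Y := by
        by_cases hδ5 : 5 ≤ δ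
        · have hδ' : δ = 5 := by omega
          subst hδ'
          omega
        · have h1 : (22 - T) * (11 - 7) ≤ (22 - T) * (11 + 1 - 2 * δ) := Nat.mul_le_mul_left _ (by omega)
          omega
      omega
    · -- maximum degree `6`: `|R| = 20`, `m′ = 10`
      have hRc' : Rc = 20 := by omega
      have hEc' : Ec = 10 := by omega
      subst hRc' hEc'
      have hY : 2 * T + 24 ≤ Y := by
        by_cases hδ5 : 5 ≤ δ
        · rcases (by omega : δ = 5 ∨ δ = 6) with hδ' | hδ' <;> subst hδ' <;> omega
        · have h1 : (20 - T) * (10 - 7) ≤ (20 - T) * (10 + 1 - 2 * δ) := Nat.mul_le_mul_left _ (by omega)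
          omega
      omega
    · -- maximum degree `7`: `|R| = 18`, `m′ = 9`
      have hRc' : Rc = 18 := by omega
      have hEc' : Ec = 9 := by omega
      subst hRc' hEc'
      have hY : 2 * T + 8 ≤ Y := by
        by_cases hδ5 : 5 ≤ δ
        · rcases (by omega : δ = 5 ∨ δ = 6 ∨ δ = 7) with hδ' | hδ' | hδ' <;> subst hδ' <;> omega
        · have h1 : (18 - T) * (9 - 7) ≤ (18 - T) * (9 + 1 - 2 * δ) := Nat.mul_le_mul_left _ (by omega)
          omega
      omega
    · -- maximum degree `8`: `|R| = 16`, `m′ = 8`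
      have hRc' : Rc = 16 := by omega
      have hEc' : Ec = 8 := by omega
      subst hRc' hEc'
      have h0 := Nat.zero_le ((16 - T) * (8 + 1 - 2 * δ))
      omega
    · -- maximum degree `9`: `|R| = 14`, `m′ = 7`
      have hRc' : Rc = 14 := by omega
      have hEc' : Ec = 7 := by omega
      subst hRc' hEc'
      have h0 := Nat.zero_le ((14 - T) * (7 + 1 - 2 * δ))
      omega
    · -- maximum degree `10`: `|R| = 12`, `m′ = 6`
      have hT2 := hdom (by omega)
      omega


end C047

end TriangleCap

end PercRepro
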